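import Literature.AlgebraicGeometry.HodgeTheory.AbelianVarietyExactEndomorphisms
import Literature.AlgebraicGeometry.HodgeTheory.AbelianVarietyEndomorphismEntropyMahlerMeasure
import Literature.AlgebraicGeometry.HodgeTheory.AbelianVarietyIsogenyDegreeHomology
import Mathlib.LinearAlgebra.Charpoly.BaseChange
import HarnessLib

/-!
# Exact endomorphisms of a complex abelian variety have degree `≥ 2` and topological entropy `≥ log 2`

Lane `lit-hodgefound`, row A1-30⁺ / (A1-30⁺ `AbelianVarietyExactEndomorphisms`, `AbelianVarietyEndomorphismEntropyMahlerMeasure`)⁺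
(prover seat `lit-hodgefound-p31`): the junction of the seat's EXACTNESS story (Krzyżewski's criterion:
`AbelianVariety.isExactEndomorphism_mapContinuous_iff_forall_not_dvd_charpoly` — an isogeny `f` of a complex
abelian variety `A` is an exact endomorphism of `(A(ℂ), Haar)` iff no unimodular polynomial divides
`χ(f(ℂ)^* | H¹(A(ℂ); ℚ))`) with its ENTROPY story (Bowen's formula and `log deg f ≤ h(f(ℂ))`,
`AbelianVariety.log_natCard_kerPoints_le_coverEntropy_mapContinuous`) through Lange's Prop. 1.1.13 (c)
(`deg f = #Ker f(ℂ) = |det(f(ℂ)_* | H₁(A(ℂ); ℤ))|`, `IsIsogeny.natCard_kerPoints_eq_natAbs_det`).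

## The printed statements

* K. K. S. Andersen, K. Thomsen, Doc. Math. 17 (2012), **Theorem 4.1** (held arXiv:1204.0224 chunk p0010):
  «(Krzyzewski, [Kr]) Let `A ∈ M_n(ℤ)` be non-singular […] `φ_A` of `𝕋ⁿ` is strongly transitive [⟺ exact,
  Prop. 2.9] if and only if no unimodular polynomial divides `f_A`» (unimodular: monic, integral, positive degree,
  constant term `±1` — so `f_A` itself must not be unimodular: `|det A| ≠ 1`).
* P. Walters, *An Introduction to Ergodic Theory* (1982), §4.9 Definition 4.14 and the remark after it (held
  text chunk p0126): «So exact endomorphisms are as far from being invertible as possible»; §8.4 **Theorem 8.15**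
  (held chunk p0212): the entropy of an affine map of the torus with linear part `A` is `Σ_{|λᵢ|>1} log|λᵢ|`
  (eigenvalues of `A`).
* H. Lange, *Abelian Varieties over the Complex Numbers* (2023), §1.1.2 **Prop. 1.1.13 (c)** (PDF p. 22):
  `deg f = |det ρ_r(f)|` for an isogeny `f`; §2.4.1 Cor. 2.4.4 (a) (PDF p. 114).

## What is formalised (theorems only; no definition, no named fact)

For a complex abelian variety `A` of positive dimension, an endomorphism `f : A ⟶ A`, the Borel σ-algebra and the
Haar probability measure `μ` of `A(ℂ)`, and the hypothesis that `f(ℂ)` is an exact endomorphism of `(A(ℂ), μ)`: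
* `AbelianVariety.isIsogeny_of_isExactEndomorphism_mapContinuous` — `f` is an isogeny;
* `AbelianVariety.not_isUnit_det_singularHomology_map_one_of_isExactEndomorphism` — `det(f(ℂ)_* | H₁(A(ℂ); ℤ))`
  is not `±1` (else `χ(f(ℂ)_* | H₁)` would be a unimodular factor of `χ(f(ℂ)^* | H¹(A(ℂ); ℚ))`);
* **`AbelianVariety.two_le_natCard_kerPoints_of_isExactEndomorphism`** — `deg f = #Ker f(ℂ) ≥ 2` («exact
  endomorphisms are as far from being invertible as possible», quantified);
* **`AbelianVariety.log_two_le_coverEntropy_mapContinuous_of_isExactEndomorphism`** — `log 2 ≤ log deg f ≤ h(f(ℂ))`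
  for every uniform structure on `A(ℂ)` compatible with its topology, and
  `AbelianVariety.coverEntropy_mapContinuous_pos_of_isExactEndomorphism` (`h(f(ℂ)) > 0`).

## References

* [AndersenThomsen2012] K. K. S. Andersen, K. Thomsen, Doc. Math. 17 (2012) 545–572, §4 Thm. 4.1, §2.5 Prop. 2.9
  (held text arXiv:1204.0224 chunks p0010, p0007).
* [Krzyzewski1993] K. Krzyżewski, *On exact toral endomorphisms*, Monatsh. Math. 116 (1993) 39–47 (cite-only).
* [Walters1982] P. Walters, *An Introduction to Ergodic Theory*, GTM 79 (1982), §4.9 Definition 4.14 (held text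
  chunk p0126); §8.4 Theorem 8.15 (held chunk p0212).
* [Lange2023AbelianVarietiesComplex] H. Lange, *Abelian Varieties over the Complex Numbers*, Springer (2023),
  §1.1.2 Prop. 1.1.13 (c) (PDF p. 22), §2.4.1 Cor. 2.4.4 (a) (PDF p. 114).
-/

noncomputable section

-- nested instance problems on the carriers (cf. `AbelianVarietyExactEndomorphisms.lean`)
set_option maxSynthPendingDepth 3

open CategoryTheory Module Function MeasureTheory MeasureTheory.Measure Set Polynomial Filter Topology Dynamics
open Literature.AlgebraicTopology.SingularHomology Literature.Dynamics.Ergodic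
open Literature.AlgebraicGeometry.Motives (ComplexPoints AbelianVariety AlgPoints specOver)
open Literature.AlgebraicGeometry.Motives.AbelianVariety (Hom.kerPoints)

namespace Literature.AlgebraicGeometry.HodgeTheory

section ExactEntropy

variable (A : AbelianVariety ℂ) (f : A ⟶ A) [MeasurableSpace (ComplexPoints A.X)] [BorelSpace (ComplexPoints A.X)]
  (μ : Measure (ComplexPoints A.X)) [IsProbabilityMeasure μ]
  (hμ : ∀ Q : A.Points ℂ, Measure.map (fun P : A.Points ℂ ↦ P * Q) μ = μ)

include hμ in
/-- **An exact endomorphism of `(A(ℂ), μ)` is an isogeny** (a non-isogeny is not even measure-preserving).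
[cite: AndersenThomsen2012, §4 Theorem 4.1 (held text arXiv:1204.0224 chunk p0010)]
[cite: Walters1982, §4.9 Definition 4.14 (held text chunk p0126)] -/
theorem AbelianVariety.isIsogeny_of_isExactEndomorphism_mapContinuous
    (h : IsExactEndomorphism (AlgPoints.mapContinuous (L := ℂ) f.hom.hom.hom) μ) :
    Motives.AbelianVariety.IsIsogeny f := by
  by_contra hf
  exact AbelianVariety.not_isExactEndomorphism_mapContinuous_of_not_isIsogeny A f μ hμ hf h

omit [MeasurableSpace (ComplexPoints A.X)] [BorelSpace (ComplexPoints A.X)] in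
/-- **`χ(f(ℂ)^* | H¹(A(ℂ); ℚ)) = χ(f(ℂ)_* | H₁(A(ℂ); ℤ)) ⊗ ℚ`** (both become `χ_{ρ_r(f)}` over `ℂ`,
`AbelianVariety.charpoly_singularCohomology_rat_map_one_map_eq`; `ℚ → ℂ` is injective).
[cite: Lange2023AbelianVarietiesComplex, §1.1.3 Lemma 1.1.17 (PDF p. 23)] -/
theorem AbelianVariety.charpoly_singularCohomology_rat_map_one_eq_map_charpoly_singularHomology
    [Module.Free ℤ (singularHomology ℤ ℤ (ComplexPoints A.X) 1)] [Module.Finite ℤ (singularHomology ℤ ℤ (ComplexPoints A.X) 1)] :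
    (singularCohomology.map ℚ ℚ (AlgPoints.mapContinuous (L := ℂ) f.hom.hom.hom) 1).hom.charpoly =
      (singularHomology.map ℤ ℤ (AlgPoints.mapContinuous (L := ℂ) f.hom.hom.hom) 1).hom.charpoly.map
        (Int.castRingHom ℚ) := by
  apply Polynomial.map_injective (algebraMap ℚ ℂ) (algebraMap ℚ ℂ).injective
  rw [AbelianVariety.charpoly_singularCohomology_rat_map_one_map_eq A f, Polynomial.map_map]
  congr 1

include hμ in
/-- **For an exact `f(ℂ)` on a positive-dimensional `A`, `det(f(ℂ)_* | H₁(A(ℂ); ℤ))` is not a unit** — otherwise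
the monic integer polynomial `χ(f(ℂ)_* | H₁(A(ℂ); ℤ))`, of degree `2 dim A > 0` and constant term `± det = ±1`, would
be a unimodular divisor of `χ(f(ℂ)^* | H¹(A(ℂ); ℚ))`, against Krzyżewski's criterion («no unimodular polynomial
divides `f_A`»). [cite: AndersenThomsen2012, §4 Theorem 4.1 and §2.5 Proposition 2.9 (held text arXiv:1204.0224 chunks p0010, p0007)]
[cite: Krzyzewski1993, Theorem (abstract)] -/
theorem AbelianVariety.not_isUnit_det_singularHomology_map_one_of_isExactEndomorphism (hA : 0 < A.dim)
    (h : IsExactEndomorphism (AlgPoints.mapContinuous (L := ℂ) f.hom.hom.hom) μ) :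
    ¬ IsUnit (LinearMap.det (singularHomology.map ℤ ℤ (AlgPoints.mapContinuous (L := ℂ) f.hom.hom.hom) 1).hom) := by
  haveI := AbelianVariety.free_singularHomology_int A 1
  haveI := AbelianVariety.finite_singularHomology_int A 1
  intro hunit
  have hf := AbelianVariety.isIsogeny_of_isExactEndomorphism_mapContinuous A f μ hμ h
  set χ : ℤ[X] := (singularHomology.map ℤ ℤ (AlgPoints.mapContinuous (L := ℂ) f.hom.hom.hom) 1).hom.charpoly
    with hχ
  -- `χ` is unimodular
  have hmonic : χ.Monic := LinearMap.charpoly_monic _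
  have hdeg : 0 < χ.natDegree := by
    rw [hχ, LinearMap.charpoly_natDegree, AbelianVariety.finrank_singularHomology_int_one A]
    omega
  have hcoeff : IsUnit (χ.coeff 0) := by
    have hdet := LinearMap.det_eq_sign_charpoly_coeff
      (singularHomology.map ℤ ℤ (AlgPoints.mapContinuous (L := ℂ) f.hom.hom.hom) 1).hom
    rw [hdet] at hunit
    exact isUnit_of_mul_isUnit_right hunit
  -- and divides `χ(f(ℂ)^* | H¹(A(ℂ); ℚ))`, contradicting Krzyżewski's criterion
  have hK := (AbelianVariety.isExactEndomorphism_mapContinuous_iff_forall_not_dvd_charpoly A f μ hμ hf).1 h χ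
    hmonic hdeg hcoeff
  apply hK
  rw [AbelianVariety.charpoly_singularCohomology_rat_map_one_eq_map_charpoly_singularHomology A f]

include hμ in
/-- **Exact endomorphisms have degree at least two: `deg f = #Ker f(ℂ) ≥ 2`** for an exact `f(ℂ)` on a
positive-dimensional `A` (`deg f = |det(f(ℂ)_* | H₁(A(ℂ); ℤ))|`, Prop. 1.1.13 (c); the determinant is non-zero — `f`
is an isogeny — and not `±1`): «exact endomorphisms are as far from being invertible as possible».
[cite: Lange2023AbelianVarietiesComplex, §1.1.2 Prop. 1.1.13 (c) (PDF p. 22)]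
[cite: Walters1982, §4.9 Definition 4.14 and the remark after it (held text chunk p0126)]
[cite: AndersenThomsen2012, §4 Theorem 4.1 (held text arXiv:1204.0224 chunk p0010)] -/
theorem AbelianVariety.two_le_natCard_kerPoints_of_isExactEndomorphism (hA : 0 < A.dim)
    (h : IsExactEndomorphism (AlgPoints.mapContinuous (L := ℂ) f.hom.hom.hom) μ) :
    2 ≤ Nat.card (Hom.kerPoints (specOver ℂ ℂ) f) := by
  have hf := AbelianVariety.isIsogeny_of_isExactEndomorphism_mapContinuous A f μ hμ h
  rw [hf.natCard_kerPoints_eq_natAbs_det]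
  have hne : LinearMap.det (singularHomology.map ℤ ℤ (AlgPoints.mapContinuous (L := ℂ) f.hom.hom.hom) 1).hom
      ≠ 0 := (AbelianVariety.isIsogeny_iff_det_singularHomology_map_one_ne_zero f).1 hf
  have hnu := AbelianVariety.not_isUnit_det_singularHomology_map_one_of_isExactEndomorphism A f μ hμ hA h
  rw [Int.isUnit_iff_natAbs_eq] at hnu
  have h0 : (LinearMap.det (singularHomology.map ℤ ℤ (AlgPoints.mapContinuous (L := ℂ) f.hom.hom.hom) 1).hom).natAbs
      ≠ 0 := Int.natAbs_ne_zero.2 hne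
  omega

include hμ in
/-- **Exact endomorphisms have topological entropy at least `log 2`: `log 2 ≤ log deg f ≤ h(f(ℂ))`** for an exact
`f(ℂ)` on a positive-dimensional complex abelian variety and every uniform structure on `A(ℂ)` inducing its topology
(Bowen's formula gives `h(f(ℂ)) = Σ_{|λ|>1} log|λ| ≥ log|det ρ_r(f)| = log deg f`).
[cite: Walters1982, §8.4 Theorem 8.15 (held text chunk p0212) and §4.9 Definition 4.14 (held chunk p0126)]
[cite: Lange2023AbelianVarietiesComplex, §1.1.2 Prop. 1.1.13 (c) (PDF p. 22) and §2.4.1 Cor. 2.4.4 (a) (PDF p. 114)]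
[cite: AndersenThomsen2012, §4 Theorem 4.1 (held text arXiv:1204.0224 chunk p0010)] -/
theorem AbelianVariety.log_two_le_coverEntropy_mapContinuous_of_isExactEndomorphism (hA : 0 < A.dim)
    (u : UniformSpace (A.Points ℂ)) (hu : u.toTopologicalSpace = (inferInstance : TopologicalSpace (A.Points ℂ)))
    (h : IsExactEndomorphism (AlgPoints.mapContinuous (L := ℂ) f.hom.hom.hom) μ) :
    ((Real.log 2 : ℝ) : EReal) ≤ @coverEntropy (A.Points ℂ) u (AlgPoints.mapContinuous (L := ℂ) f.hom.hom.hom) univ := by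
  haveI := AbelianVariety.free_singularHomology_int A 1
  haveI := AbelianVariety.finite_singularHomology_int A 1
  refine le_trans ?_ (AbelianVariety.log_natCard_kerPoints_le_coverEntropy_mapContinuous A u hu f)
  rw [EReal.coe_le_coe_iff]
  have h2 := AbelianVariety.two_le_natCard_kerPoints_of_isExactEndomorphism A f μ hμ hA h
  exact Real.log_le_log (by norm_num) (by exact_mod_cast h2)

include hμ in
/-- **Exact endomorphisms have positive topological entropy** (`h(f(ℂ)) ≥ log 2 > 0`).
[cite: Walters1982, §8.4 Theorem 8.15 (held text chunk p0212) and §4.9 Definition 4.14 (held chunk p0126)]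
[cite: AndersenThomsen2012, §4 Theorem 4.1 (held text arXiv:1204.0224 chunk p0010)] -/
theorem AbelianVariety.coverEntropy_mapContinuous_pos_of_isExactEndomorphism (hA : 0 < A.dim)
    (u : UniformSpace (A.Points ℂ)) (hu : u.toTopologicalSpace = (inferInstance : TopologicalSpace (A.Points ℂ)))
    (h : IsExactEndomorphism (AlgPoints.mapContinuous (L := ℂ) f.hom.hom.hom) μ) :
    0 < @coverEntropy (A.Points ℂ) u (AlgPoints.mapContinuous (L := ℂ) f.hom.hom.hom) univ := by
  refine lt_of_lt_of_le ?_ (AbelianVariety.log_two_le_coverEntropy_mapContinuous_of_isExactEndomorphism A f μ hμ hA u hu h)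
  exact_mod_cast Real.log_pos (by norm_num)

end ExactEntropy

end Literature.AlgebraicGeometry.HodgeTheory
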